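import Literature.Probability.LatticeModels.AnnulusManeuver
import HarnessLib

/-!
# The target crossing of the shielding lemma (corrected Chelkak 2016, Lemma 2.14)

Sub-problem `CriticalPhenomena/SAWScalingLimit`, crux `AvoidanceLimit`, line `symplectic-fermion-anchor`
(lead c5, §shield), companion of `…ShieldCore.lean`. A lattice walk from the germ box
`|· - x̂₁|_∞ ≤ k` to the outside of the maneuver box `mW c k` whose vertices inside the box avoid
the (linear) cap of the clean disc crosses transversally one of the admissible strips of the
circuit designs: for a northward slit (`aCrossing_N`, `c = x̂₁ + (0, 9k)`, cap
`12 (z₁ - x̂₁₁) - 5 |z₀ - x̂₁₀| ≥ 45 k`) the truncated right strip, the bottom strip or the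
truncated left strip; for a north-eastward slit (`aCrossing_NE`, `c = x̂₁ + (6k, 6k)`, cap
`17 X + 7 Y ≥ 64 k ∧ 7 X + 17 Y ≥ 64 k`) the right strip below `-9k`, the bottom strip, the full
left strip or the top strip left of `-9k`. Proof: `exists_strip_crossing` and linear arithmetic
(the top strip / the upper windows lie in the cap).

## References

* D. Chelkak, Robust discrete complex analysis: a toolbox, Ann. Probab. 44 (2016), Lemma 2.14.
  [Chelkak2016]
-/

noncomputable section

open scoped BigOperators Classical
open Literature.Probability.LatticeModels

namespace Summit.CriticalPhenomena.SAWScalingLimit.Theorems.AvoidanceLimit.Anchor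

/-! ### The `A`-crossing supplied by a walk that avoids the cap -/

/-- **The target crossing, northward slit.** A lattice walk from the germ box `|· - x̂₁|_∞ ≤ k`
to the outside of `mW c k` (`c = x̂₁ + (0, 9k)`) whose vertices inside the box avoid the cap
`12 (z₁ - x̂₁₁) - 5 |z₀ - x̂₁₀| ≥ 45 k` crosses transversally the truncated right strip, the
bottom strip or the truncated left strip of the northward circuits. [cite: Chelkak2016, Lemma 2.14] -/
theorem aCrossing_N :
    ∀ (c x₁ : Site 2) (k : ℕ), 0 < k → c 0 = x₁ 0 → c 1 = x₁ 1 + 9 * k →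
      ∀ {v₀ v₁ : Site 2} (γ : (zdGraph 2).Walk v₀ v₁), |v₀ 0 - x₁ 0| ≤ k → |v₀ 1 - x₁ 1| ≤ k →
      (48 * (k : ℤ) < |v₁ 0 - c 0| ∨ 48 * (k : ℤ) < |v₁ 1 - c 1|) →
      (∀ z ∈ γ.support, |z 0 - c 0| ≤ 48 * k → |z 1 - c 1| ≤ 48 * k →
        12 * (z 1 - x₁ 1) - 5 * |z 0 - x₁ 0| < 45 * k) →
      ((∃ (u v : Site 2) (σ : (zdGraph 2).Walk u v), u 0 = c 0 + 12 * k ∧ v 0 = c 0 + 36 * k ∧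
          ∀ z ∈ σ.support, z ∈ {z | z ∈ γ.support} ∧
            c 0 + 12 * k ≤ z 0 ∧ z 0 ≤ c 0 + 36 * k ∧ c 1 - 36 * k ≤ z 1 ∧ z 1 ≤ c 1 + 17 * k) ∨
       (∃ (u v : Site 2) (σ : (zdGraph 2).Walk u v), u 1 = c 1 - 36 * k ∧ v 1 = c 1 - 12 * k ∧
          ∀ z ∈ σ.support, z ∈ {z | z ∈ γ.support} ∧
            c 0 - 36 * k ≤ z 0 ∧ z 0 ≤ c 0 + 36 * k ∧ c 1 - 36 * k ≤ z 1 ∧ z 1 ≤ c 1 - 12 * k) ∨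
       (∃ (u v : Site 2) (σ : (zdGraph 2).Walk u v), u 0 = c 0 - 36 * k ∧ v 0 = c 0 - 12 * k ∧
          ∀ z ∈ σ.support, z ∈ {z | z ∈ γ.support} ∧
            c 0 - 36 * k ≤ z 0 ∧ z 0 ≤ c 0 - 12 * k ∧ c 1 - 36 * k ≤ z 1 ∧ z 1 ≤ c 1 + 17 * k)) := by
  intro c x₁ k hk hc0 hc1 v₀ v₁ γ hv0 hv1 hend hcap
  rw [abs_le] at hv0 hv1
  obtain ⟨u, v, σ, hsub, hcases⟩ := exists_strip_crossing (c := c) (B₁ := 12 * k) (B₃ := 36 * k) (by omega) γ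
    ⟨by rw [abs_le]; constructor <;> omega, by rw [abs_le]; constructor <;> omega⟩
    (by
      rcases hend with h | h
      · left; rw [lt_abs] at h; rw [le_abs]; rcases h with h | h <;> [left; right] <;> omega
      · right; rw [lt_abs] at h; rw [le_abs]; rcases h with h | h <;> [left; right] <;> omega)
  rcases hcases with ⟨hu, hv, hσ⟩ | ⟨hu, hv, hσ⟩ | ⟨hu, hv, hσ⟩ | ⟨hu, hv, hσ⟩
  · -- top strip: impossible, its end lies in the cap
    exfalso
    have hvs := hσ v (SimpleGraph.Walk.end_mem_support σ)
    have hvc := hcap v (hsub v (SimpleGraph.Walk.end_mem_support σ)) (by rw [abs_le]; constructor <;> omega)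
      (by rw [abs_le]; constructor <;> omega)
    rcases abs_cases (v 0 - x₁ 0) with ⟨h, _⟩ | ⟨h, _⟩ <;> rw [h] at hvc <;> omega
  · -- bottom strip
    right; left
    exact ⟨u, v, σ, hu, hv, fun z hz => ⟨hsub z hz, hσ z hz⟩⟩
  · -- right strip, truncated by the cap
    left
    refine ⟨u, v, σ, hu, hv, fun z hz => ⟨hsub z hz, (hσ z hz).1, (hσ z hz).2.1, (hσ z hz).2.2.1, ?_⟩⟩
    have hzs := hσ z hz
    have hzc := hcap z (hsub z hz) (by rw [abs_le]; constructor <;> omega) (by rw [abs_le]; constructor <;> omega)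
    rcases abs_cases (z 0 - x₁ 0) with ⟨h, _⟩ | ⟨h, _⟩ <;> rw [h] at hzc <;> omega
  · -- left strip, truncated by the cap
    right; right
    refine ⟨u, v, σ, hu, hv, fun z hz => ⟨hsub z hz, (hσ z hz).1, (hσ z hz).2.1, (hσ z hz).2.2.1, ?_⟩⟩
    have hzs := hσ z hz
    have hzc := hcap z (hsub z hz) (by rw [abs_le]; constructor <;> omega) (by rw [abs_le]; constructor <;> omega)
    rcases abs_cases (z 0 - x₁ 0) with ⟨h, _⟩ | ⟨h, _⟩ <;> rw [h] at hzc <;> omega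

/-- **The target crossing, north-eastward slit.** The same for `c = x̂₁ + (6k, 6k)` and the cap
`17 X + 7 Y ≥ 64 k ∧ 7 X + 17 Y ≥ 64 k` (`X = z₀ - x̂₁₀`, `Y = z₁ - x̂₁₁`): the walk crosses the
right strip below `-9k`, the bottom strip, the full left strip, or the top strip left of `-9k`. [cite: Chelkak2016, Lemma 2.14] -/
theorem aCrossing_NE :
    ∀ (c x₁ : Site 2) (k : ℕ), 0 < k → c 0 = x₁ 0 + 6 * k → c 1 = x₁ 1 + 6 * k →
      ∀ {v₀ v₁ : Site 2} (γ : (zdGraph 2).Walk v₀ v₁), |v₀ 0 - x₁ 0| ≤ k → |v₀ 1 - x₁ 1| ≤ k →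
      (48 * (k : ℤ) < |v₁ 0 - c 0| ∨ 48 * (k : ℤ) < |v₁ 1 - c 1|) →
      (∀ z ∈ γ.support, |z 0 - c 0| ≤ 48 * k → |z 1 - c 1| ≤ 48 * k →
        17 * (z 0 - x₁ 0) + 7 * (z 1 - x₁ 1) < 64 * k ∨ 7 * (z 0 - x₁ 0) + 17 * (z 1 - x₁ 1) < 64 * k) →
      ((∃ (u v : Site 2) (σ : (zdGraph 2).Walk u v), u 0 = c 0 + 12 * k ∧ v 0 = c 0 + 36 * k ∧
          ∀ z ∈ σ.support, z ∈ {z | z ∈ γ.support} ∧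
            c 0 + 12 * k ≤ z 0 ∧ z 0 ≤ c 0 + 36 * k ∧ c 1 - 36 * k ≤ z 1 ∧ z 1 ≤ c 1 - 9 * k) ∨
       (∃ (u v : Site 2) (σ : (zdGraph 2).Walk u v), u 1 = c 1 - 36 * k ∧ v 1 = c 1 - 12 * k ∧
          ∀ z ∈ σ.support, z ∈ {z | z ∈ γ.support} ∧
            c 0 - 36 * k ≤ z 0 ∧ z 0 ≤ c 0 + 36 * k ∧ c 1 - 36 * k ≤ z 1 ∧ z 1 ≤ c 1 - 12 * k) ∨
       (∃ (u v : Site 2) (σ : (zdGraph 2).Walk u v), u 0 = c 0 - 36 * k ∧ v 0 = c 0 - 12 * k ∧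
          ∀ z ∈ σ.support, z ∈ {z | z ∈ γ.support} ∧
            c 0 - 36 * k ≤ z 0 ∧ z 0 ≤ c 0 - 12 * k ∧ c 1 - 36 * k ≤ z 1 ∧ z 1 ≤ c 1 + 36 * k) ∨
       (∃ (u v : Site 2) (σ : (zdGraph 2).Walk u v), u 1 = c 1 + 12 * k ∧ v 1 = c 1 + 36 * k ∧
          ∀ z ∈ σ.support, z ∈ {z | z ∈ γ.support} ∧
            c 0 - 36 * k ≤ z 0 ∧ z 0 ≤ c 0 - 9 * k ∧ c 1 + 12 * k ≤ z 1 ∧ z 1 ≤ c 1 + 36 * k)) := by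
  intro c x₁ k hk hc0 hc1 v₀ v₁ γ hv0 hv1 hend hcap
  rw [abs_le] at hv0 hv1
  obtain ⟨u, v, σ, hsub, hcases⟩ := exists_strip_crossing (c := c) (B₁ := 12 * k) (B₃ := 36 * k) (by omega) γ
    ⟨by rw [abs_le]; constructor <;> omega, by rw [abs_le]; constructor <;> omega⟩
    (by
      rcases hend with h | h
      · left; rw [lt_abs] at h; rw [le_abs]; rcases h with h | h <;> [left; right] <;> omega
      · right; rw [lt_abs] at h; rw [le_abs]; rcases h with h | h <;> [left; right] <;> omega)
  rcases hcases with ⟨hu, hv, hσ⟩ | ⟨hu, hv, hσ⟩ | ⟨hu, hv, hσ⟩ | ⟨hu, hv, hσ⟩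
  · -- top strip, truncated by the cap
    right; right; right
    refine ⟨u, v, σ, hu, hv, fun z hz => ⟨hsub z hz, (hσ z hz).1, ?_, (hσ z hz).2.2.1, (hσ z hz).2.2.2⟩⟩
    have hzs := hσ z hz
    have hzc := hcap z (hsub z hz) (by rw [abs_le]; constructor <;> omega) (by rw [abs_le]; constructor <;> omega)
    rcases hzc with h | h <;> omega
  · -- bottom strip
    right; left
    exact ⟨u, v, σ, hu, hv, fun z hz => ⟨hsub z hz, hσ z hz⟩⟩
  · -- right strip, truncated by the cap
    left
    refine ⟨u, v, σ, hu, hv, fun z hz => ⟨hsub z hz, (hσ z hz).1, (hσ z hz).2.1, (hσ z hz).2.2.1, ?_⟩⟩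
    have hzs := hσ z hz
    have hzc := hcap z (hsub z hz) (by rw [abs_le]; constructor <;> omega) (by rw [abs_le]; constructor <;> omega)
    rcases hzc with h | h <;> omega
  · -- left strip, full
    right; right; left
    exact ⟨u, v, σ, hu, hv, fun z hz => ⟨hsub z hz, hσ z hz⟩⟩

end Summit.CriticalPhenomena.SAWScalingLimit.Theorems.AvoidanceLimit.Anchor

end
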